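/-
Copyright (c) 2026. All rights reserved.
Released under Apache 2.0 license as described in the file LICENSE.
Authors: abc-iut cell, campaign-S prover seat abc-iut-S1 (gen 2).
-/
import Mathlib.RingTheory.DedekindDomain.Different
import Mathlib.NumberTheory.NumberField.Basic
import HarnessLib

/-!
# The absolute different of a number field: base `ℤ` versus base `𝓞 ℚ`

For a number field `L`, Mathlib's absolute different `differentIdeal ℤ (𝓞 L)` (as in `NumberField.absNorm_differentIdeal`
and the abc-iut cell's `differentDivisor F := ofIdeal (differentIdeal ℤ (𝓞 F))`, [GenEll] Def. 1.5 (iii)) coincides with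
the relative different `differentIdeal (𝓞 ℚ) (𝓞 L)` over the ring of integers of the number field `ℚ` (the form in which
the relative theory — transitivity, and `Literature.NumberTheory.NumberFields.pow_dvd_differentIdeal_iff_local`, «the
different is preserved by completion», stated for extensions of number fields `L/K` — applies with `K = ℚ`):
both are the inverse of the codifferent `(𝓞 L)^* = {x : Tr_{L/ℚ}(x·𝓞 L) ⊆ ℤ}` (Mathlib `coeIdeal_differentIdeal`), and
`ℤ → ℚ`, `𝓞 ℚ → ℚ` have the same range.  THEOREMS ONLY.

Source: J.-P. Serre, *Local Fields*, Ch. III §3 (the different as the inverse of the codifferent; it depends only on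
the pair of fraction fields and the integral closures). Classical; nothing here bears on anything disputed.
-/

noncomputable section

open scoped NumberField nonZeroDivisors

namespace Literature.NumberTheory.NumberFields

open NumberField

/-- `𝓞 ℚ → ℚ` and `ℤ → ℚ` have the same range (both are `ℤ ⊆ ℚ`: `𝓞 ℚ` is the integral closure of `ℤ`, which is
integrally closed). [cite: SerreLocalFields1979, Ch. III §3 Prop. 7] -/
theorem range_algebraMap_ringOfIntegers_rat :
    (algebraMap (𝓞 ℚ) ℚ).range = (algebraMap ℤ ℚ).range := by
  ext y
  constructor
  · rintro ⟨b, rfl⟩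
    exact IsIntegrallyClosed.isIntegral_iff.mp (RingOfIntegers.isIntegral_coe b)
  · rintro ⟨z, rfl⟩
    exact ⟨algebraMap ℤ (𝓞 ℚ) z, (IsScalarTower.algebraMap_apply ℤ (𝓞 ℚ) ℚ z).symm⟩

variable (L : Type*) [Field L] [NumberField L]

/-- The codifferent of `𝓞 L` is the same whether the base is taken to be `ℤ` or `𝓞 ℚ`.
[cite: SerreLocalFields1979, Ch. III §3 Prop. 7] -/
theorem dual_int_eq_dual_ringOfIntegers_rat :
    FractionalIdeal.dual ℤ ℚ (1 : FractionalIdeal (𝓞 L)⁰ L) =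
      FractionalIdeal.dual (𝓞 ℚ) ℚ (1 : FractionalIdeal (𝓞 L)⁰ L) := by
  have h1 : (1 : FractionalIdeal (𝓞 L)⁰ L) ≠ 0 := one_ne_zero
  ext x
  rw [FractionalIdeal.mem_dual h1, FractionalIdeal.mem_dual h1, range_algebraMap_ringOfIntegers_rat]

/-- **`differentIdeal ℤ (𝓞 L) = differentIdeal (𝓞 ℚ) (𝓞 L)`**: the absolute different of a number field does not
depend on presenting the base as `ℤ` or as `𝓞 ℚ`. [cite: SerreLocalFields1979, Ch. III §3 Prop. 7] -/
theorem differentIdeal_int_eq_differentIdeal_ringOfIntegers_rat :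
    differentIdeal ℤ (𝓞 L) = differentIdeal (𝓞 ℚ) (𝓞 L) := by
  rw [← FractionalIdeal.coeIdeal_inj (K := L), coeIdeal_differentIdeal ℤ ℚ L (𝓞 L),
    coeIdeal_differentIdeal (𝓞 ℚ) ℚ L (𝓞 L), dual_int_eq_dual_ringOfIntegers_rat]

end Literature.NumberTheory.NumberFields

end
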